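import Summits.PneNP.PneNP.Theorems.ConvexRankGatesConvexGateBlindExactLiftingTriangleRegroupingRigidityOfCov

/-!
# Triangle instance — the covering bound by LP duality: `3t² ≤ #family` from a dual certificate, and what equality forces

Support file for crux `ConvexGateBlind` (stmt-PneNP-10680), open stub `stub_exactLifting`; prover seat 0, session 35,
memo ANALYSIS14 §5.4. The DUALITY SKELETON of COV-rigidity (the hypothesis of `regroupingRigid_of_cov`), for an arbitrary dual
certificate: weights `w L x ≥ 0` on (line, row) pairs, supported on nondegenerate rows under which the line is monochromatic, of
total mass `1` for every line (in the memo: the biased probability measures `y_L`). For a family `E i` of sets of lines that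
COVERS (every monochromatic line of every nondegenerate row lies in a member all of whose lines are monochromatic) put
`cost i := Σ_{L ∈ E i} Σ_x w L x · [all lines of E i monochromatic under x]` (the memo's `c(E_i)`).
* `three_mul_sq_le_sum_cost`: `3t² ≤ Σ_i cost i` (sum the covering inequalities against `w`);
* `cov_card_bound`: if every member has `cost i ≤ 1` then `3t² ≤ #ι`;
* `cov_tight_of_card_eq`: if moreover `#ι = 3t²` then every member is TIGHT (`cost i = 1`) and the cover is EXACT: for every
  `(L, x)` in the support of `w` exactly one member contains `L` with all its lines monochromatic under `x`.
What remains for COV-rigidity(t) is specific to the certificate of the memo: `cost ≤ 1` for EVERY nonempty set of lines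
(ANALYSIS14 §5.5, paper proof for `t ≥ 5`) and "tight + exact cover ⇒ singletons" (§5.6).
Registered sub-goal `triangle_cov_card_bound` (self-contained signature).
-/

set_option linter.dupNamespace false -- `Summit.PneNP.PneNP.…`: summit = sub-problem (D-0017)

namespace Summit.PneNP.PneNP.Theorems.XorDoor.TriLine

open Finset

noncomputable section

variable {t : ℕ} {ι : Type} [Fintype ι]

/-- indicator that all lines of `S` are monochromatic under `x` -/
def allMono (x : Col t) (S : Finset (Line t)) : ℝ := if ∀ L' ∈ S, lmono x L' then 1 else 0

/-- `allMono ∈ {0,1}`, non-negative -/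
lemma allMono_nonneg (x : Col t) (S : Finset (Line t)) : 0 ≤ allMono x S := by
  unfold allMono; split_ifs <;> norm_num

/-- the product of the line patterns over `S` is the all-monochromatic indicator -/
lemma prod_mInd_eq_allMono (x : Col t) (S : Finset (Line t)) : ∏ L' ∈ S, mInd x L' = allMono x S := by
  unfold allMono
  split_ifs with h
  · exact prod_eq_one fun L' hL' => by unfold mInd; rw [if_pos (h L' hL')]
  · push Not at h
    obtain ⟨L', hL', hm⟩ := h
    exact prod_eq_zero hL' (by unfold mInd; rw [if_neg hm])

/-- the cost of a member of the family against the certificate `w` -/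
def cost (w : Line t → Col t → ℝ) (S : Finset (Line t)) : ℝ := ∑ L ∈ S, ∑ x : Col t, w L x * allMono x S

/-- **Duality, summed form**: `3t² ≤ Σ_i cost_w(E i)` for a covering family and a certificate `w` (non-negative, supported on
nondegenerate rows under which the line is monochromatic, mass `1` per line). -/
theorem three_mul_sq_le_sum_cost (E : ι → Finset (Line t))
    (hcov : ∀ x : Col t, mu x ≠ 0 → ∀ L, lmono x L → ∃ i, L ∈ E i ∧ ∀ L' ∈ E i, lmono x L')
    (w : Line t → Col t → ℝ) (hw0 : ∀ L x, 0 ≤ w L x) (hws : ∀ L x, w L x ≠ 0 → mu x ≠ 0 ∧ lmono x L)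
    (hw1 : ∀ L, ∑ x : Col t, w L x = 1) :
    (3 * (t : ℝ) ^ 2) ≤ ∑ i, cost w (E i) := by
  classical
  have hcardL : (Fintype.card (Line t) : ℝ) = 3 * (t : ℝ) ^ 2 := by
    simp only [Line, Fintype.card_sum, Fintype.card_prod, Fintype.card_fin]; push_cast; ring
  -- pointwise: `w L x ≤ w L x · #{i : L ∈ E i, E i all mono}`
  have key : ∀ L x, w L x ≤ ∑ i, w L x * ((if L ∈ E i then 1 else 0) * allMono x (E i)) := by
    intro L x
    by_cases h0 : w L x = 0
    · rw [h0]; simp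
    · obtain ⟨hx, hL⟩ := hws L x h0
      obtain ⟨i, hi, hall⟩ := hcov x hx L hL
      have hterm : w L x * ((if L ∈ E i then 1 else 0) * allMono x (E i)) = w L x := by
        rw [if_pos hi]; unfold allMono; rw [if_pos hall]; ring
      have hnn : ∀ j ∈ (univ : Finset ι), 0 ≤ w L x * ((if L ∈ E j then 1 else 0) * allMono x (E j)) := by
        intro j _
        refine mul_nonneg (hw0 L x) (mul_nonneg ?_ (allMono_nonneg x _))
        split_ifs <;> norm_num
      calc w L x = w L x * ((if L ∈ E i then 1 else 0) * allMono x (E i)) := hterm.symm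
        _ ≤ ∑ j, w L x * ((if L ∈ E j then 1 else 0) * allMono x (E j)) :=
            single_le_sum (f := fun j => w L x * ((if L ∈ E j then 1 else 0) * allMono x (E j))) hnn (mem_univ i)
  calc (3 * (t : ℝ) ^ 2) = ∑ L : Line t, (1 : ℝ) := by rw [sum_const, card_univ, nsmul_eq_mul, mul_one, hcardL]
    _ = ∑ L : Line t, ∑ x : Col t, w L x := sum_congr rfl fun L _ => (hw1 L).symm
    _ ≤ ∑ L : Line t, ∑ x : Col t, ∑ i, w L x * ((if L ∈ E i then 1 else 0) * allMono x (E i)) :=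
        sum_le_sum fun L _ => sum_le_sum fun x _ => key L x
    _ = ∑ L : Line t, ∑ i, ∑ x : Col t, w L x * ((if L ∈ E i then 1 else 0) * allMono x (E i)) :=
        sum_congr rfl fun L _ => sum_comm
    _ = ∑ i, ∑ L : Line t, ∑ x : Col t, w L x * ((if L ∈ E i then 1 else 0) * allMono x (E i)) := sum_comm
    _ = ∑ i, cost w (E i) := by
        refine sum_congr rfl fun i _ => ?_
        unfold cost
        rw [← sum_subset (subset_univ (E i))]
        · refine sum_congr rfl fun L hL => sum_congr rfl fun x _ => ?_
          rw [if_pos hL]; ring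
        · intro L _ hL
          exact sum_eq_zero fun x _ => by rw [if_neg hL]; ring

/-- **The covering bound**: if every member costs at most `1` against the certificate, the family has `≥ 3t²` members. -/
theorem cov_card_bound (E : ι → Finset (Line t))
    (hcov : ∀ x : Col t, mu x ≠ 0 → ∀ L, lmono x L → ∃ i, L ∈ E i ∧ ∀ L' ∈ E i, lmono x L')
    (w : Line t → Col t → ℝ) (hw0 : ∀ L x, 0 ≤ w L x) (hws : ∀ L x, w L x ≠ 0 → mu x ≠ 0 ∧ lmono x L)
    (hw1 : ∀ L, ∑ x : Col t, w L x = 1) (hc : ∀ i, cost w (E i) ≤ 1) :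
    3 * t ^ 2 ≤ Fintype.card ι := by
  have h := three_mul_sq_le_sum_cost E hcov w hw0 hws hw1
  have h2 : ∑ i, cost w (E i) ≤ (Fintype.card ι : ℝ) := by
    calc ∑ i, cost w (E i) ≤ ∑ _i : ι, (1 : ℝ) := sum_le_sum fun i _ => hc i
      _ = Fintype.card ι := by rw [sum_const, card_univ, nsmul_eq_mul, mul_one]
  exact_mod_cast h.trans h2

/-- **Equality forces tightness and an exact cover**: with `#ι = 3t²` and all costs `≤ 1`, every member has cost exactly `1`,
and every `(L, x)` in the support of the certificate is covered by EXACTLY ONE member (no overlaps of positive weight). -/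
theorem cov_tight_of_card_eq (E : ι → Finset (Line t))
    (hcov : ∀ x : Col t, mu x ≠ 0 → ∀ L, lmono x L → ∃ i, L ∈ E i ∧ ∀ L' ∈ E i, lmono x L')
    (w : Line t → Col t → ℝ) (hw0 : ∀ L x, 0 ≤ w L x) (hws : ∀ L x, w L x ≠ 0 → mu x ≠ 0 ∧ lmono x L)
    (hw1 : ∀ L, ∑ x : Col t, w L x = 1) (hc : ∀ i, cost w (E i) ≤ 1) (hcard : Fintype.card ι = 3 * t ^ 2) :
    (∀ i, cost w (E i) = 1) ∧
      ∀ L x, w L x ≠ 0 → ∀ i j, L ∈ E i → (∀ L' ∈ E i, lmono x L') → L ∈ E j → (∀ L' ∈ E j, lmono x L') → i = j := by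
  classical
  have hsum := three_mul_sq_le_sum_cost E hcov w hw0 hws hw1
  have hcardR : (Fintype.card ι : ℝ) = 3 * (t : ℝ) ^ 2 := by rw [hcard]; push_cast; ring
  -- all costs are exactly 1
  have htight : ∀ i, cost w (E i) = 1 := by
    by_contra hno
    push Not at hno
    obtain ⟨i₀, hi₀⟩ := hno
    have hlt : cost w (E i₀) < 1 := lt_of_le_of_ne (hc i₀) hi₀
    have : ∑ i, cost w (E i) < ∑ _i : ι, (1 : ℝ) :=
      sum_lt_sum (fun i _ => hc i) ⟨i₀, mem_univ _, hlt⟩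
    rw [sum_const, card_univ, nsmul_eq_mul, mul_one, hcardR] at this
    linarith
  refine ⟨htight, ?_⟩
  -- no double cover of positive weight: otherwise the summed inequality would be strict
  intro L x hwx i j hi hiall hj hjall
  by_contra hne
  -- redo the summation with the point `(L, x)` counted twice
  have hcardL : (Fintype.card (Line t) : ℝ) = 3 * (t : ℝ) ^ 2 := by
    simp only [Line, Fintype.card_sum, Fintype.card_prod, Fintype.card_fin]; push_cast; ring
  set g : Line t → Col t → ι → ℝ := fun L x k => w L x * ((if L ∈ E k then 1 else 0) * allMono x (E k)) with hg
  have hgnn : ∀ L x k, 0 ≤ g L x k := by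
    intro L x k; simp only [hg]
    refine mul_nonneg (hw0 L x) (mul_nonneg ?_ (allMono_nonneg x _)); split_ifs <;> norm_num
  have key : ∀ L' x', w L' x' ≤ ∑ k, g L' x' k := by
    intro L' x'
    by_cases h0 : w L' x' = 0
    · rw [h0]; exact sum_nonneg fun k _ => hgnn L' x' k
    · obtain ⟨hx, hL⟩ := hws L' x' h0
      obtain ⟨k, hk, hall⟩ := hcov x' hx L' hL
      have hterm : g L' x' k = w L' x' := by
        simp only [hg]; rw [if_pos hk]; unfold allMono; rw [if_pos hall]; ring
      have hnn : ∀ k' ∈ (univ : Finset ι), 0 ≤ g L' x' k' := fun k' _ => hgnn L' x' k'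
      calc w L' x' = g L' x' k := hterm.symm
        _ ≤ ∑ k', g L' x' k' := single_le_sum (f := fun k' => g L' x' k') hnn (mem_univ k)
  -- at the doubly covered point the inequality is strict
  have hgi : g L x i = w L x := by simp only [hg]; rw [if_pos hi]; unfold allMono; rw [if_pos hiall]; ring
  have hgj : g L x j = w L x := by simp only [hg]; rw [if_pos hj]; unfold allMono; rw [if_pos hjall]; ring
  have hwpos : 0 < w L x := lt_of_le_of_ne (hw0 L x) (Ne.symm hwx)
  have hstrict : w L x < ∑ k, g L x k := by
    have h2 : g L x i + g L x j ≤ ∑ k, g L x k := by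
      rw [← sum_pair hne]
      exact sum_le_sum_of_subset_of_nonneg (subset_univ _) fun k _ _ => hgnn L x k
    linarith
  have hlt : ∑ L' : Line t, ∑ x' : Col t, w L' x' < ∑ L' : Line t, ∑ x' : Col t, ∑ k, g L' x' k := by
    refine sum_lt_sum (fun L' _ => sum_le_sum fun x' _ => key L' x') ⟨L, mem_univ _, ?_⟩
    exact sum_lt_sum (fun x' _ => key L x') ⟨x, mem_univ _, hstrict⟩
  have hL1 : ∑ L' : Line t, ∑ x' : Col t, w L' x' = 3 * (t : ℝ) ^ 2 := by
    rw [sum_congr rfl fun L' _ => hw1 L', sum_const, card_univ, nsmul_eq_mul, mul_one, hcardL]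
  have hR : ∑ L' : Line t, ∑ x' : Col t, ∑ k, g L' x' k = ∑ k, cost w (E k) := by
    calc ∑ L' : Line t, ∑ x' : Col t, ∑ k, g L' x' k = ∑ L' : Line t, ∑ k, ∑ x' : Col t, g L' x' k :=
          sum_congr rfl fun L' _ => sum_comm
      _ = ∑ k, ∑ L' : Line t, ∑ x' : Col t, g L' x' k := sum_comm
      _ = ∑ k, cost w (E k) := by
          refine sum_congr rfl fun k _ => ?_
          unfold cost
          rw [← sum_subset (subset_univ (E k))]
          · refine sum_congr rfl fun L' hL' => sum_congr rfl fun x' _ => ?_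
            simp only [hg]; rw [if_pos hL']; ring
          · intro L' _ hL'
            exact sum_eq_zero fun x' _ => by simp only [hg]; rw [if_neg hL']; ring
  have htot : ∑ k, cost w (E k) = 3 * (t : ℝ) ^ 2 := by
    rw [sum_congr rfl fun k _ => htight k, sum_const, card_univ, nsmul_eq_mul, mul_one, hcardR]
  rw [hL1, hR, htot] at hlt
  exact lt_irrefl _ hlt

/-- **The covering bound by duality** (registered sub-goal `triangle_cov_card_bound` of stmt-PneNP-10680, verbatim signature,
self-contained vocabulary): a family of `R` sets of lines of the triangle instance covering every (nondegenerate row,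
monochromatic line) pair by a member of monochromatic lines has `R ≥ 3t²` as soon as some non-negative certificate `w` — mass
`1` per line, supported on nondegenerate rows under which the line is monochromatic — gives every member cost `≤ 1`. -/
theorem triangle_cov_card_bound : ∀ (t R : ℕ) (E : Fin R → Finset ((Fin t × Fin t) ⊕ (Fin t × Fin t) ⊕ (Fin t × Fin
    t))) (w : (Fin t × Fin t) ⊕ (Fin t × Fin t) ⊕ (Fin t × Fin t) → (Fin t → Bool) × (Fin t → Bool) × (Fin t → Bool)
    → ℝ), (∀ x : (Fin t → Bool) × (Fin t → Bool) × (Fin t → Bool), ((∃ a a', x.1 a ≠ x.1 a') ∧ (∃ b b', x.2.1 b ≠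
    x.2.1 b') ∧ (∃ d d', x.2.2 d ≠ x.2.2 d')) → ∀ L, Sum.elim (fun ab : Fin t × Fin t => x.1 ab.1 = x.2.1 ab.2)
    (Sum.elim (fun ad : Fin t × Fin t => x.1 ad.1 = x.2.2 ad.2) (fun bd : Fin t × Fin t => x.2.1 bd.1 = x.2.2 bd.2)) L
    → ∃ i, L ∈ E i ∧ ∀ L' ∈ E i, Sum.elim (fun ab : Fin t × Fin t => x.1 ab.1 = x.2.1 ab.2) (Sum.elim (fun ad : Fin t
    × Fin t => x.1 ad.1 = x.2.2 ad.2) (fun bd : Fin t × Fin t => x.2.1 bd.1 = x.2.2 bd.2)) L') → (∀ L x, 0 ≤ w L x) →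
    (∀ L x, w L x ≠ 0 → ((∃ a a', x.1 a ≠ x.1 a') ∧ (∃ b b', x.2.1 b ≠ x.2.1 b') ∧ (∃ d d', x.2.2 d ≠ x.2.2 d')) ∧
    Sum.elim (fun ab : Fin t × Fin t => x.1 ab.1 = x.2.1 ab.2) (Sum.elim (fun ad : Fin t × Fin t => x.1 ad.1 = x.2.2
    ad.2) (fun bd : Fin t × Fin t => x.2.1 bd.1 = x.2.2 bd.2)) L) → (∀ L, ∑ x, w L x = 1) → (∀ i, ∑ L ∈ E i, ∑ x, w L
    x * ∏ L' ∈ E i, Sum.elim (fun ab : Fin t × Fin t => if x.1 ab.1 = x.2.1 ab.2 then (1 : ℝ) else 0) (Sum.elim (fun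
    ad : Fin t × Fin t => if x.1 ad.1 = x.2.2 ad.2 then (1 : ℝ) else 0) (fun bd : Fin t × Fin t => if x.2.1 bd.1 =
    x.2.2 bd.2 then (1 : ℝ) else 0)) L' ≤ 1) → 3 * t ^ 2 ≤ R := by
  intro t R E w hcov hw0 hws hw1 hc
  have hc' : ∀ i, cost w (E i) ≤ 1 := by
    intro i
    have h := hc i
    unfold cost
    rw [← sum_congr rfl fun L _ => sum_congr rfl fun x _ => by
      rw [← prod_mInd_eq_allMono x (E i), prod_congr rfl fun L' _ => mInd_eq_elim x L']]
    exact h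
  have h := cov_card_bound (ι := Fin R) E
    (fun x hx L hL => hcov x ((mu_ne_zero_iff_two_coloured x).1 hx) L hL) w hw0
    (fun L x h => ⟨(mu_ne_zero_iff_two_coloured x).2 (hws L x h).1, (hws L x h).2⟩) hw1 hc'
  rwa [Fintype.card_fin] at h

end

end Summit.PneNP.PneNP.Theorems.XorDoor.TriLine
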